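import Summits.HodgeConjecture.HodgeConjecture.Theorems.R90S1ClosureE3Defs   -- ★ D1 p862727 (R90-C10-typ2 (g2)): `ExtE3Fin`, `ExtE3Arch`, `ExtE3`, `extE3_iff` — SETTLED TEXT, never edited; brings rows' letters `ArchPacketSignsLetter`, `ArchTorusOrbitalOneSidedLimits`, `ArchLimitFormulaNoncompactWall`, `ArchCharactersLinIndep`, the LeThree letters
import HarnessLib

/-!
# R90-TF · S1 (Rogawski 1990 Ch. 12, local) · ★ D1-CM — `R90S1ClosureE3DefsCM`: the (E3) closure predicate with rows E3.R2 CM-BOUND (WEAKENING OF RECORD)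

WEAKENING OF RECORD (J-34-9, LEAD #40): rows E3.R2 restricted from ∀ fields to ∀ CM number fields — no consumer on any path reads a non-CM `L` (R90-C10-audit1 fact (4));
the ★ payers `archTorusOrbitalOneSidedLimits_holds`∕`archLimitFormulaNoncompactWall_holds` bind `[NumberField L] [IsCMField L]`.

Cell hodgecm-mathlib, slab R90-TF (director brief v2), section S1 «Ch10-local» (base R90-C10), crux item h413 = stmt-HodgeConjecture-24833 (route
`route-HodgeConjecture-HCCMUnconditional`).  Author: R90-C10-typ2 (g3), D1 pen of record (junction J-34-9, szE3.4 (g3) 2026-09-04T23:14:24Z; dealer ruling R-S1-14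
23:36:28Z «(B) under the rules as written; escalated for one word»; R90-TF LEAD K2E1-plan (g8) LEAD #40 (A) 23:38:18Z «(A) IS ADMITTED as an OPENLY-LABELLED WEAKENING,
in ADDITIVE FORM (★ D1 p862727 is settled text, never edited)»; audit position R90-C10-audit1 (g2) 23:35:47Z «rows R2 over-general but NOT MISSTATED»).

WHAT THIS FILE IS.  DEFINITIONS ONLY, ADDITIVE (★ D1 `R90S1ClosureE3Defs` is imported, not edited; nothing already typed against ★ `ExtE3` is lost):
* `structure ExtE3ArchCM : Prop` = ★ `ExtE3Arch` (D1 :337–:350) VERBATIM except that the two row-E3.R2 fields `archLimitOneSided` ∕ `archLimitFormula` bind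
  `∀ (L : Type) [Field L] [NumberField L] [IsCMField L] (α) (w), …` instead of `∀ (L : Type) [Field L] (α) (w), …` (rows E3.R1 `cdPseudoCoeff` and E3.R5 `archCharLinIndep`
  byte-identical to D1 :339 and :347–:350);
* `def ExtE3CM : Prop := ExtE3Fin ∧ ExtE3ArchCM` — ★ `ExtE3`'s body with `ExtE3ArchCM` in place of `ExtE3Arch` (the finite half ★ `ExtE3Fin` is D1's, unchanged);
* the projections `theorem ExtE3Arch.toCM : ExtE3Arch → ExtE3ArchCM` and `theorem ExtE3.toCM : ExtE3 → ExtE3CM` (instantiate the ∀-field rows at CM `L`; no content),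
  and the unfolding guard `extE3CM_iff` (`Iff.rfl`), mirroring ★ `extE3_iff`;
* the elaboration guards of D1 §3 re-run against `ExtE3CM`, the row-E3.R2 guard (D1 :366–:367) now at a CM number field `L`.
WHY (LEAD #40, under NR-4 «closure sockets = build targets, frozen»): the freeze protects consumers from goalpost moves; the ∀-field generality of rows E3.R2 is read by NO
consumer on any path (h413 quantifies over CM `L` only; ★ D1 itself binds CM in row E3.R5, so the R2 generality was incidental — audit fact (4)), while the ★ Literature payers
of these rows — `Literature.NumberTheory.Rogawski1990.archTorusOrbitalOneSidedLimits_holds` (`ArchTorusOrbitalOneSidedLimitsProof` :98 + :127) and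
`Literature.NumberTheory.Rogawski1990.archLimitFormulaNoncompactWall_holds` (`ArchLimitFormulaNoncompactWallProof` :50 + :55) — bind `(L : Type) [Field L] [NumberField L]
[IsCMField L] (α : Fin 3 → L) (w : {w : InfinitePlace L // IsComplex w})`; binding the rows the same way makes them payable BY NAME and saves the (B) transport brick (real-diagonal
rescaling onto a CM frame, 1–3 kLoC, szE3.4 ED. 6∕7) for generality nobody consumes.  CONSEQUENCE OF RECORD: C ED. 2 of `Cruxes/H413/Lines/R90_S1_ClosureE3C.lean` re-types the
closure socket `stub_R90_ext_E3 : ExtE3` ↦ `stub_R90_ext_E3 : ExtE3CM` (socket NAME unchanged; «ED. 2 — E3.R2 TYPE WEAKENED TO CM (J-34-9)»); R90 closure DAG r6 row E3.R2 := «CM-bound».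
The mathematics dropped is idle, not false: each ∀-field instance is Harish-Chandra's limit formula for the real group `U(diag(σ_w α))`, true at every field `L` (the frame guards
`α_i ≠ 0`, `(σ_w α_i).im = 0`, indefiniteness sit INSIDE the Props) [§8.2 p. 119 via [A₁] L. 7.1; Varadarajan1989 §6.4 Thms 18, 20, 22].

No `sorry`, no `instance`, no `notation`, no new carrier; imports ★ D1 + `HarnessLib` only (no `Cruxes/…/Lines` import — law L9 «definitions down», no cycle).
Namespace `Summit.HodgeConjecture.HodgeConjecture.R90.S1` (= D1's).

HONEST LABEL.  HC_CM is proved only modulo the 7 printed citations (2 remaining named inputs: hLiu418 = stmt-HodgeConjecture-24832, h413 = stmt-HodgeConjecture-24833)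
until rung 0 closes; this file closes NOTHING at rung 0 — it RE-TYPES two conjuncts of the (E3) build target, weaker than ★ D1 and labelled so; REL ≠ ★ ≠ BUILT.

References: [cite: Rogawski1990, §8.2 p. 119; §12.5 p. 182; §13.8 Prop. 13.8.1 p. 212, p. 218] [cite: Varadarajan1989, §6.4 Thm 18, Thm 20, Thm 22]
[cite: ClozelDelorme1984] [cite: LabesseLanglands1979, Lemma 6.1 pp. 768–769]
-/

set_option autoImplicit false
-- the mandated namespace has the single-problem summit's repeated segment (`HodgeConjecture.HodgeConjecture`)
set_option linter.dupNamespace false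

noncomputable section

open MeasureTheory Measure Filter Topology NumberField IsDedekindDomain
open scoped NNReal Matrix MatrixGroups
open Literature.NumberTheory.Rogawski1990
open Literature.NumberTheory.Automorphic Literature.NumberTheory.Automorphic.UnitaryGroup
open Summit.HodgeConjecture.HodgeConjecture.Cruxes.H413.K2E1bGKCohomologyU21.U8 (ArchPacketSignsLetter)
open Summit.HodgeConjecture.HodgeConjecture.Cruxes.H413.K2E3CharLettersLeThreeDefs (characterLocallyIntegrableLeThree normalizedCharacter_locallyBoundedLeThree)

namespace Summit.HodgeConjecture.HodgeConjecture.R90.S1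

/-! ## §1 The CM-bound archimedean closure predicate `ExtE3ArchCM` and the closure predicate `ExtE3CM` (closed Props) -/

/-- **(E3, real places; rows E3.R2 CM-BOUND) `ExtE3ArchCM`** — WEAKENING OF RECORD (J-34-9, LEAD #40) of ★ `ExtE3Arch`: the closure predicate «archimedean harmonic
analysis» (CLOSED `Prop`) with
* `cdPseudoCoeff` (row E3.R1) := ★ `ArchPacketSignsLetter` — byte-identical to ★ `ExtE3Arch.cdPseudoCoeff` [§13.8 p. 218; ClozelDelorme1984];
* `archLimitOneSided`, `archLimitFormula` (row E3.R2) := ★ `ArchTorusOrbitalOneSidedLimits`, ★ `ArchLimitFormulaNoncompactWall` at every CM NUMBER FIELD `L` (binders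
  `[NumberField L] [IsCMField L]` — the ONLY change w.r.t. ★ `ExtE3Arch`, which binds every field `L`), diagonal form `α` and complex place `w` (frame guards inside the Props) —
  Harish-Chandra's limit formula at a noncompact wall [§8.2 p. 119 via [A₁] L. 7.1; Varadarajan1989 §6.4 Thms 18, 20, 22]; payable BY NAME by ★ `archTorusOrbitalOneSidedLimits_holds`
  ∕ ★ `archLimitFormulaNoncompactWall_holds`;
* `archCharLinIndep` (row E3.R5) := ★ `ArchCharactersLinIndep` at every CM frame — byte-identical to ★ `ExtE3Arch.archCharLinIndep` [Prop. 13.8.1 p. 212; LabesseLanglands1979 L. 6.1].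
[cite: Rogawski1990, §13.8 p. 218, Prop. 13.8.1 p. 212; §8.2 p. 119] [cite: ClozelDelorme1984] [cite: Varadarajan1989, §6.4 Thm 18, Thm 20, Thm 22]
[cite: LabesseLanglands1979, Lemma 6.1 pp. 768–769] -/
structure ExtE3ArchCM : Prop where
  /-- row E3.R1 [cite: Rogawski1990, §13.8 p. 218] [cite: ClozelDelorme1984]. -/
  cdPseudoCoeff : ArchPacketSignsLetter
  /-- row E3.R2 (one-sided limits), CM-bound (J-34-9) [cite: Varadarajan1989, §6.4 Thm 18, Thm 20] [cite: Rogawski1990, §8.2 p. 119]. -/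
  archLimitOneSided : ∀ (L : Type) [Field L] [NumberField L] [IsCMField L] (α : Fin 3 → L) (w : {w : InfinitePlace L // InfinitePlace.IsComplex w}),
    ArchTorusOrbitalOneSidedLimits L α w
  /-- row E3.R2 (the limit formula at a noncompact wall), CM-bound (J-34-9) [cite: Varadarajan1989, §6.4 Thm 22, Lemma 21] [cite: Rogawski1990, §8.2 p. 119]. -/
  archLimitFormula : ∀ (L : Type) [Field L] [NumberField L] [IsCMField L] (α : Fin 3 → L) (w : {w : InfinitePlace L // InfinitePlace.IsComplex w}),
    ArchLimitFormulaNoncompactWall L α w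
  /-- row E3.R5 [cite: Rogawski1990, Prop. 13.8.1 p. 212] [cite: LabesseLanglands1979, Lemma 6.1 pp. 768–769]. -/
  archCharLinIndep : ∀ (L : Type) [Field L] [NumberField L] [IsCMField L] (ι : L →+* ℂ) (H : Matrix (Fin 3) (Fin 3) L) (T : GL (Fin 3) ℂ)
    (hT : (T : Matrix (Fin 3) (Fin 3) ℂ)ᴴ * H.map ι * (T : Matrix (Fin 3) (Fin 3) ℂ) = Literature.Geometry.ComplexHyperbolic.BallModel.J)
    (νinf : @Measure (UnitaryGroup.arch (↥(maximalRealSubfield L)) L (IsCMField.complexConj L) 3 H) (borel _)),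
    ArchCharactersLinIndep L ι H T hT νinf

/-- **(E3) `ExtE3CM`** — the closure predicate «local harmonic analysis» with rows E3.R2 CM-bound (WEAKENING OF RECORD of ★ `ExtE3`, J-34-9 ∕ LEAD #40): finite places
(★ `ExtE3Fin`, D1's, unchanged) ∧ real places (`ExtE3ArchCM`).  The TYPE of the closure socket `stub_R90_ext_E3` of `Cruxes/H413/Lines/R90_S1_ClosureE3C.lean` from its
ED. 2 on = BUILD TARGET (NR-4 FINAL; R90 closure DAG rows E3.P1 P3 P5 P6 P10 R1 R2 R5, row E3.R2 «CM-bound»).  (Rogawski1990, §1.6 pp. 5–6; §12.5–§12.6 pp. 182–189;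
§13.8 p. 218; §8.2 p. 119) — a route-posited closure-INPUT statement typed over Summits-side carriers (the conjunction of two `structure … : Prop` bundles whose fields
carry the locators), not a relocatable result of the literature (hence untagged). -/
def ExtE3CM : Prop := ExtE3Fin ∧ ExtE3ArchCM

/-- Unfolding of `ExtE3CM` (elaboration guard; `Iff.rfl`). [cite: Rogawski1990, §12.5 p. 182] -/
theorem extE3CM_iff : ExtE3CM ↔ ExtE3Fin ∧ ExtE3ArchCM := Iff.rfl

/-! ## §2 The projections from the ★ D1 predicates (nothing typed against ★ `ExtE3` is lost; no content) -/

/-- ★ `ExtE3Arch` ⟹ `ExtE3ArchCM`: instantiate the ∀-field rows E3.R2 at CM number fields (a WEAKENING, J-34-9 ∕ LEAD #40). [cite: Rogawski1990, §8.2 p. 119] -/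
theorem ExtE3Arch.toCM (h : ExtE3Arch) : ExtE3ArchCM :=
  ⟨h.cdPseudoCoeff, fun L _ _ _ α w => h.archLimitOneSided L α w, fun L _ _ _ α w => h.archLimitFormula L α w, h.archCharLinIndep⟩

/-- ★ `ExtE3` ⟹ `ExtE3CM` (the projection of record: ED. 1 socket type ⟹ ED. 2 socket type). [cite: Rogawski1990, §12.5 p. 182; §8.2 p. 119] -/
theorem ExtE3.toCM (h : ExtE3) : ExtE3CM := ⟨h.1, h.2.toCM⟩

/-! ## §3 Elaboration guards: the conjuncts consumers read, by projection (no content); row E3.R2 at a CM number field `L` -/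

example (h : ExtE3CM) : characterLocallyIntegrableLeThree := h.1.regularity
example (h : ExtE3CM) : normalizedCharacter_locallyBoundedLeThree := h.1.normCharLocBdd
example (h : ExtE3CM) : ArchPacketSignsLetter := h.2.cdPseudoCoeff
example (h : ExtE3CM) (L : Type) [Field L] [NumberField L] [IsCMField L] (α : Fin 3 → L) (w : {w : InfinitePlace L // InfinitePlace.IsComplex w}) :
    ArchTorusOrbitalOneSidedLimits L α w := h.2.archLimitOneSided L α w
example (h : ExtE3CM) (L : Type) [Field L] [NumberField L] [IsCMField L] (α : Fin 3 → L) (w : {w : InfinitePlace L // InfinitePlace.IsComplex w}) :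
    ArchLimitFormulaNoncompactWall L α w := h.2.archLimitFormula L α w
example (h : ExtE3) : ExtE3CM := h.toCM

end Summit.HodgeConjecture.HodgeConjecture.R90.S1

end
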